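import Literature.NumberTheory.Automorphic.UnitaryGroupTruncatedKernelClassIntegrableOfRows
import Literature.NumberTheory.Automorphic.UnitaryGroupTruncatedKernelIntegrableHolds
import HarnessLib

/-!
# Every `k^T_𝔬` IS INTEGRABLE for the quasi-split `U(J₃)` of a CM extension: the row package of the Siegel set
# as DATA, and the per-class closer

(Arthur, *A trace formula for reductive groups I*, Duke Math. J. 45 (1978), Thm. 7.1: «for `T` sufficiently
regular, `k^T_𝔬` is integrable»; Rogawski, *Automorphic Representations of Unitary Groups in Three Variables*
(1990), §2.2 p. 13: «Furthermore, `k^T_𝔬` is integrable over `𝐙G\𝐆`».)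

Topic `NumberTheory/Automorphic`; namespace `Literature.NumberTheory.Automorphic.UnitaryGroup`. THEOREMS ONLY
(no definition, no named fact, no instance, no notation, no `sorry`). The trunk's closer (C6) of the T1-qs LAW 3
road (`𝔬`-expansion) of `Cruxes/H413/Lines/F0_T1InnerFormTraceIdentity.lean` (cell `pub/hodgecm-mathlib`,
crux H413):

* §1 **`exists_rows_of_levelDepth`** — THE ROW PACKAGE AS DATA: for a quadratic `E/F` (`c² = 1`, `c ≠ 1`,
  `[E:F] = 2`) with the adelic Iwasawa decomposition and the level depth `hdepth` of the dilated fundamental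
  domains on the Siegel set, there are a compact direction set `S_dir` and, for every Haar measure `ν` of
  `N(𝔸)`, the `hrows` package of ★ `truncatedKernelIntegrable_of_rows` ∕ ★ `truncatedKernelClassIntegrable_of_rows`
  (Siegel set `S = Ω · S_T · K_B`, structure clause, three-factor geometry at scale `ρ`, `δ_B ρ` integrable high
  in the cusp) — the proof of ★ `truncatedKernelIntegrable_of_levelDepth` (`UnitaryGroupTruncatedKernelIntegrableOfSiegel`)
  with its output exported instead of consumed; `exists_rows_cm` — the same at `(L⁺, L, complexConj)` with
  `hBK` and `hdepth` discharged (★ `exists_mem_borelAdelic_mul_mem_standardMaximalCompactGL_cm_three`, ★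
  `exists_rational_borel_forall_valuation_conj_le`).
* §2 **`truncatedKernelClassIntegrable_cm`** — for every conjugation-invariant, `N(F)`-saturated class map `cl`
  on `G(F)`, every Haar measure `ν`, fundamental domain `𝓕`, automorphic measure `μ`, test function `f` and
  class `𝔬`: `[g] ↦ k^T_𝔬(g⁻¹)` is `μ`-integrable for all `T > T₀(f, 𝔬)` — NO HYPOTHESIS beyond the class map
  axioms (★ `truncatedKernelClassIntegrable_cm_of_rows` ∘ §1); `truncatedKernelClassIntegrable_of_unimodular_iwasawa`
  — generic quadratic `E/F`.

## References
* J. Arthur, *A trace formula for reductive groups I*, Duke Math. J. 45 (1978), Thm. 7.1, §8 (pp. 947–950)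
  [Arthur1978TraceFormulaI].
* J. D. Rogawski, *Automorphic Representations of Unitary Groups in Three Variables*, Ann. of Math. Stud.
  123 (1990), §2.2 (p. 13) [Rogawski1990].
* A. Borel, *Introduction aux groupes arithmétiques* (1969), §12–§13 [Borel1969].
-/

set_option autoImplicit false

noncomputable section

open MeasureTheory Measure NumberField NumberField.mixedEmbedding IsDedekindDomain Set Topology
open scoped NNReal ENNReal Pointwise MatrixGroups Classical

namespace Literature.NumberTheory.Automorphic

namespace UnitaryGroup

variable {F E : Type} [Field F] [NumberField F] [Field E] [NumberField E] [Algebra F E]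
  {c : E ≃ₐ[F] E} {ι : Type*}

/-! ## §1 The row package of the Siegel set as data -/

/-- `N(𝔸_F)` is closed in `G(𝔸_F)` (plumbing; as in `UnitaryGroupTruncatedKernelIntegrableOfSiegel`). [folklore] -/
private theorem isClosed_adelicUnipotent₁₂ :
    IsClosed ((adelicUnipotent F E c 3 : Set (quasiSplit F E c 3).Adelic)) := by
  haveI : T2Space (FiniteAdeleRing (𝓞 E) E) := inferInstanceAs <| T2Space
    (RestrictedProduct (fun w : HeightOneSpectrum (𝓞 E) => w.adicCompletion E)
      (fun w => (w.adicCompletionIntegers E : Set (w.adicCompletion E))) Filter.cofinite)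
  haveI : T2Space (InfiniteAdeleRing E) :=
    inferInstanceAs <| T2Space ((w : InfinitePlace E) → w.Completion)
  haveI : T2Space (AdeleRing (𝓞 E) E) := inferInstanceAs <| T2Space (InfiniteAdeleRing E × FiniteAdeleRing (𝓞 E) E)
  change IsClosed (⇑(adelicVal F E c 3 ((StdForm.antidiagonal 3).over E)) ⁻¹'
    ((upperUnitriangular (Fin 3) (AdeleRing (𝓞 E) E) : Subgroup (GL (Fin 3) (AdeleRing (𝓞 E) E))) :
      Set (GL (Fin 3) (AdeleRing (𝓞 E) E))))
  exact (isClosed_upperUnitriangular (R := AdeleRing (𝓞 E) E)).preimage continuous_subtype_val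

/-- **THE ROW PACKAGE OF THE SIEGEL SET AS DATA** (generic quadratic `E/F`).  Given `c² = 1`, `c ≠ 1`,
`[E:F] = 2`, the adelic Iwasawa decomposition `hBK` and the level depth `hdepth` (★
`exists_rational_borel_forall_valuation_conj_le`'s statement), there are a compact set `S_dir` of directions and,
for every Haar measure `ν` of `N(𝔸)`, a left Haar measure `μ_B` of `B(𝔸)`, the Siegel set `S = Ω · S_T · K_B`
(closed, `K_B`-saturated, covering — rows H9a, H9b), compacta `Ω_G, R₁, R₂` with the structure clause above
height `1`, and for every admissible level `U` a fundamental domain `β⁻¹ 𝓕_N β ⊆ W₀` of `N(F)` with the three-factor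
geometry at scale `ρ(b) = C_U · max root norms` and `∫⁻_{S ∩ {T < H}} δ_B ρ dμ_B < ∞` (GLUE (ρ), rows H10a/H10b)
— the `hrows` binder of ★ `truncatedKernelIntegrable_of_rows`, produced exactly as in the proof of ★
`truncatedKernelIntegrable_of_levelDepth`. [cite: Arthur1978TraceFormulaI, §8 (pp. 947–950)]
[cite: Rogawski1990, §2.2 (p. 13)] [cite: Borel1969, §13.1] -/
theorem exists_rows_of_levelDepth (hc : c * c = 1) (hc1 : c ≠ 1)
    (h2 : Module.finrank F E = 2)
    (hBK : ∀ g : (quasiSplit F E c 3).Adelic, ∃ b ∈ borelAdelic F E c 3, ∃ k : (quasiSplit F E c 3).Adelic,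
      adelicVal F E c 3 ((StdForm.antidiagonal 3).over E) k ∈ standardMaximalCompactGL 3 E ∧ g = b * k)
    (hdepth : ∀ {Ω ST : Set (borelAdelic F E c 3)}, IsCompact Ω → ∀ {W : Set (AdeleRing (𝓞 E) E)ˣ},
      IsCompact W → (∀ t ∈ ST, torusPart t = t) →
      (∀ t ∈ ST, ∃ w ∈ W, ∃ r : ℝ≥0ˣ, diagUnit t.2 0 = w * posRealIdele E r ∧ diagUnit t.2 1 ∈ W) →
      ∀ {𝔫 : Ideal (𝓞 E)}, 𝔫 ≠ 0 →
      ∃ β : borelAdelic F E c 3, (β : (quasiSplit F E c 3).Adelic) ∈ (quasiSplit F E c 3).arithmeticSubgroup ∧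
        ∀ b ∈ Ω * ST * {k : borelAdelic F E c 3 |
            adelicVal F E c 3 ((StdForm.antidiagonal 3).over E) (k : (quasiSplit F E c 3).Adelic) ∈
              standardMaximalCompactGL 3 E},
        1 ≤ borelHeight (b : (quasiSplit F E c 3).Adelic) →
        ∀ u ∈ (fun v : adelicUnipotent F E c 3 =>
            (⟨(β : (quasiSplit F E c 3).Adelic)⁻¹ * (v : (quasiSplit F E c 3).Adelic) * (β : (quasiSplit F E c 3).Adelic),
              borel_inv_mul_mul_mem_adelicUnipotent β v⟩ : adelicUnipotent F E c 3)) '' heisFundamentalDomain F E c hc,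
          ∀ i j : Fin 3, i ≠ j → ∀ v : HeightOneSpectrum (𝓞 E),
            Valued.v ((((adelicVal F E c 3 _ ((b : (quasiSplit F E c 3).Adelic)⁻¹ *
                (u : (quasiSplit F E c 3).Adelic) * (b : (quasiSplit F E c 3).Adelic)) :
              GL (Fin 3) (AdeleRing (𝓞 E) E)) : Matrix (Fin 3) (Fin 3) (AdeleRing (𝓞 E) E)) i j).2 v) ≤
                idealRadius E v 𝔫 ∧
            Valued.v ((conjAdele F E c (((adelicVal F E c 3 _ ((b : (quasiSplit F E c 3).Adelic)⁻¹ *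
                (u : (quasiSplit F E c 3).Adelic) * (b : (quasiSplit F E c 3).Adelic)) :
              GL (Fin 3) (AdeleRing (𝓞 E) E)) : Matrix (Fin 3) (Fin 3) (AdeleRing (𝓞 E) E)) i j)).2 v) ≤
                idealRadius E v 𝔫) :
    ∃ S_dir : Set (Matrix (Fin 3) (Fin 3) (mixedSpace E)), IsCompact S_dir ∧
      ∀ [MeasurableSpace (adelicUnipotent F E c 3)] [BorelSpace (adelicUnipotent F E c 3)]
      [MeasurableSpace (quasiSplit F E c 3).Adelic] [BorelSpace (quasiSplit F E c 3).Adelic]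
      (ν : Measure (adelicUnipotent F E c 3)) [ν.IsHaarMeasure],
      ∃ (μB : Measure (borelAdelic F E c 3)) (_ : μB.IsHaarMeasure) (S : Set (borelAdelic F E c 3))
        (Ω : Set (quasiSplit F E c 3).Adelic) (R₁ R₂ : Set (AdeleRing (𝓞 E) E)) (T₀ : ℝ≥0),
        IsClosed S ∧
        (∀ b ∈ S, ∀ k : borelAdelic F E c 3,
          adelicVal F E c 3 ((StdForm.antidiagonal 3).over E) (k : (quasiSplit F E c 3).Adelic) ∈
            standardMaximalCompactGL 3 E → b * k ∈ S) ∧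
        (∀ g : (quasiSplit F E c 3).Adelic, ∃ β : (quasiSplit F E c 3).arithmeticSubgroup,
          β ∈ arithmeticBorel F E c 3 ∧ ∃ b ∈ S, ∃ k : (quasiSplit F E c 3).Adelic,
            adelicVal F E c 3 ((StdForm.antidiagonal 3).over E) k ∈ standardMaximalCompactGL 3 E ∧
            (β : (quasiSplit F E c 3).Adelic) * g = (b : (quasiSplit F E c 3).Adelic) * k) ∧
        IsCompact Ω ∧ IsCompact R₁ ∧ IsCompact R₂ ∧
        (∀ b ∈ S, T₀ < borelHeight (b : (quasiSplit F E c 3).Adelic) →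
          (((torusPart b)⁻¹ * b : borelAdelic F E c 3) : (quasiSplit F E c 3).Adelic) ∈ Ω ∧
          (((diagUnit b.2 0)⁻¹ * diagUnit b.2 1 : (AdeleRing (𝓞 E) E)ˣ) : AdeleRing (𝓞 E) E) ∈ R₁ ∧
          (((diagUnit b.2 0)⁻¹ * diagUnit b.2 2 : (AdeleRing (𝓞 E) E)ˣ) : AdeleRing (𝓞 E) E) ∈ R₂) ∧
        ∀ U ∈ finiteLevelsGL 3 E, ∃ (𝓕₀ W₀ : Set (adelicUnipotent F E c 3)) (ρ : borelAdelic F E c 3 → ℝ),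
          IsFundamentalDomain (rationalUnipotent F E c 3) 𝓕₀ ν ∧ IsCompact W₀ ∧ 𝓕₀ ⊆ W₀ ∧
          (∀ b ∈ S, T₀ < borelHeight (b : (quasiSplit F E c 3).Adelic) →
            ∀ k : (quasiSplit F E c 3).Adelic,
            adelicVal F E c 3 ((StdForm.antidiagonal 3).over E) k ∈ standardMaximalCompactGL 3 E →
            ∀ u ∈ 𝓕₀, ∃ (t₁ t₂ t₃ : ℝ) (X₁ X₂ X₃ : Matrix (Fin 3) (Fin 3) (mixedSpace E))
              (w : GL (Fin 3) (AdeleRing (𝓞 E) E)),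
            X₁ ∈ S_dir ∧ X₂ ∈ S_dir ∧ X₃ ∈ S_dir ∧ w ∈ U ∧ |t₁| ≤ ρ b ∧ |t₂| ≤ ρ b ∧ |t₃| ≤ ρ b ∧
            adelicVal F E c 3 _ ((((b : (quasiSplit F E c 3).Adelic) * k)⁻¹ *
                (u : (quasiSplit F E c 3).Adelic) * ((b : (quasiSplit F E c 3).Adelic) * k))) =
              GLn.ofInfinite 3 E (expGL (t₁ • X₁) * expGL (t₂ • X₂) * expGL (t₃ • X₃)) * w) ∧
          (∀ T : ℝ≥0, T₀ < T →
            ∫⁻ b in S ∩ {b | T < borelHeight (b : (quasiSplit F E c 3).Adelic)},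
              ((torusRootModulus E 3 (diagUnit b.2) : ℝ≥0) : ℝ≥0∞) * ENNReal.ofReal (ρ b) ∂μB < ∞) := by
  classical
  -- row H9a: the torus Siegel set
  obtain ⟨ST, W, hSTc, hWc, hSTt, hexp, hSTcov, ⟨R₁, R₂, hR₁, hR₂, hR⟩, ⟨κ, hbal⟩⟩ :=
    exists_torusSiegelSet F E c h2 hc1
  have hexp' : ∀ t ∈ ST, ∃ w ∈ W, ∃ r : ℝ≥0ˣ, diagUnit t.2 0 = w * posRealIdele E r ∧ diagUnit t.2 1 ∈ W :=
    fun t ht => by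
      obtain ⟨w, hw, s, h0, h1, -, -⟩ := hexp t ht
      exact ⟨w, hw, _, h0, h1⟩
  have hexp'' : ∀ t ∈ ST, ∃ w ∈ W, ∃ s : ℝ,
      diagUnit t.2 0 = w * posRealIdele E (expUnitNNReal s) ∧ diagUnit t.2 1 ∈ W :=
    fun t ht => by
      obtain ⟨w, hw, s, h0, h1, -, -⟩ := hexp t ht
      exact ⟨w, hw, s, h0, h1⟩
  -- row H9b: `Ω`, the Siegel set `S = Ω · S_T · K_B` and the cover
  obtain ⟨Ω, hΩc, hΩN, hcov⟩ := exists_isCompact_cover_three hc hBK hSTcov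
  set KB : Set (borelAdelic F E c 3) := {k : borelAdelic F E c 3 |
    adelicVal F E c 3 ((StdForm.antidiagonal 3).over E) (k : (quasiSplit F E c 3).Adelic) ∈
      standardMaximalCompactGL 3 E} with hKB
  set S : Set (borelAdelic F E c 3) := Ω * ST * KB with hS
  -- the structure clause (★ `exists_isCompact_structure_of_mem_siegel` with the LETTERS of row H9a)
  obtain ⟨ΩG, hΩGc, R₁', R₂', hR₁'c, hR₂'c, hSred⟩ := exists_isCompact_structure_of_mem_siegel hc hΩc hΩN hSTt
    hR₁ hR₂ (fun t ht h1 => (hR t ht h1).1) (fun t ht h1 => (hR t ht h1).2)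
  -- the thin superset (★ joint (P1) + ★ `mul_mul_subset_thin`)
  obtain ⟨CN, hCNc, hCNN, hCN⟩ := exists_isCompact_conj_mem hc hWc hSTt hexp'
  have hthin := mul_mul_subset_thin (Ω := Ω) hΩN hSTt hCN
  obtain ⟨hSTKc, hSTKt, hΩCNc, -⟩ := isClosed_mul_setOf_torusPart hSTc hSTt hΩc hΩN hCNc hCNN
  -- GLUE (ρ) and the ray windows
  obtain ⟨κ', hκ'0, hglue⟩ := exists_rootNorms_le_rpow_of_balance hΩN hSTt hbal
  obtain ⟨hC₀c, hC₁c, hrayS⟩ := forall_diagUnit_of_export hWc hSTt hexp''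
  -- the unipotent window as a compact subset of `N(𝔸_F)`
  set ΩN : Set (adelicUnipotent F E c 3) :=
    (Subtype.val : adelicUnipotent F E c 3 → (quasiSplit F E c 3).Adelic) ⁻¹' ΩG with hΩN'
  have hΩNc : IsCompact ΩN :=
    (isClosed_adelicUnipotent₁₂ (F := F) (E := E) (c := c)).isClosedEmbedding_subtypeVal.isCompact_preimage hΩGc
  -- the direction set of the three-factor normal form, FIXED before the rows are opened
  obtain ⟨Sdir, hSdir, h3⟩ := exists_isCompact_threeDirections_forall_threeFactor (F := F) (E := E) hc
  refine ⟨Sdir, hSdir, ?_⟩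
  intro mN bN mG bG ν hν
  haveI : LocallyCompactSpace (borelAdelic F E c 3) := locallyCompactSpace_borelAdelic
  haveI : T2Space (borelAdelic F E c 3) := t2Space_borelAdelic
  haveI : LocallyCompactSpace (torusInBorel F E c 3) :=
    (isTopSemidirect_borelAdelic (F := F) (E := E) (c := c) (N := 3)).isClosed_left.locallyCompactSpace
  set μB : Measure (borelAdelic F E c 3) := Measure.haar with hμB
  set μT : Measure (torusInBorel F E c 3) := Measure.haar with hμT
  refine ⟨μB, inferInstance, S, ΩG, R₁', R₂', 1, isClosed_mul_mul_setOf_adelicVal_mem hΩc hSTc,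
    mul_mem_mul_mul_setOf_adelicVal_mem, hcov, hΩGc, hR₁'c, hR₂'c, fun b hb hH => hSred b hb hH.le,
    fun U hU => ?_⟩
  -- per level `U`: `𝔫` with `K(𝔫) ≤ U`, the rational `β` of the level depth, `𝓕₀ = β⁻¹ 𝓕_N β ⊆ W₀`
  obtain ⟨𝔫, h𝔫, hKU, -⟩ := exists_principalCongruenceLevel_le_of_mem_finiteLevelsGL hU Filter.univ_mem
  obtain ⟨β, hβ, hval⟩ := hdepth hΩc hWc hSTt hexp' h𝔫
  obtain ⟨W₀, hW₀c, hW₀⟩ := exists_isCompact_borelConj_heisFundamentalDomain_subset hc β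
  obtain ⟨C, hC0, hgeo⟩ := h3 hW₀c hΩNc
  letI : MeasurableSpace (AdeleRing (𝓞 E) E) := borel _
  haveI : BorelSpace (AdeleRing (𝓞 E) E) := ⟨rfl⟩
  refine ⟨(fun v : adelicUnipotent F E c 3 =>
      (⟨(β : (quasiSplit F E c 3).Adelic)⁻¹ * (v : (quasiSplit F E c 3).Adelic) * (β : (quasiSplit F E c 3).Adelic),
        borel_inv_mul_mul_mem_adelicUnipotent β v⟩ : adelicUnipotent F E c 3)) '' heisFundamentalDomain F E c hc,
    W₀, fun b => C * max (max
      ‖archHom E ((((diagUnit b.2 0)⁻¹ * diagUnit b.2 1 : (AdeleRing (𝓞 E) E)ˣ)) : AdeleRing (𝓞 E) E)‖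
      ‖archHom E ((((diagUnit b.2 0)⁻¹ * diagUnit b.2 2 : (AdeleRing (𝓞 E) E)ˣ)) : AdeleRing (𝓞 E) E)‖)
      ‖archHom E ((((diagUnit b.2 1)⁻¹ * diagUnit b.2 2 : (AdeleRing (𝓞 E) E)ˣ)) : AdeleRing (𝓞 E) E)‖,
    isFundamentalDomain_borelConj_image hc β hβ ν, hW₀c, hW₀, ?_, ?_⟩
  · -- `hgeom`: the three-factor normal form on the Siegel set above height `1`
    intro b hb hHb k hk u hu
    have hn₀ : (⟨(((torusPart b)⁻¹ * b : borelAdelic F E c 3) : (quasiSplit F E c 3).Adelic),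
        torusPart_inv_mul_mem_adelicUnipotent b⟩ : adelicUnipotent F E c 3) ∈ ΩN :=
      (hSred b hb hHb.le).1
    obtain ⟨t₁, t₂, t₃, X₁, X₂, X₃, w, hX₁, hX₂, hX₃, hw, ht₁, ht₂, ht₃, e⟩ :=
      hgeo b k hk hn₀ 𝔫 u (hW₀ hu) (hval b hb hHb.le u hu)
    exact ⟨t₁, t₂, t₃, X₁, X₂, X₃, w, hX₁, hX₂, hX₃, hKU hw, ht₁, ht₂, ht₃, e⟩
  · -- `hH10`: thin-set integration (row H10a) of the GLUE (ρ) majorant over the ray (row H10b)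
    have hn0 : (0 : ℝ) < 1 / (Module.finrank ℚ E : ℝ) :=
      div_pos one_pos (by exact_mod_cast Module.finrank_pos)
    have hCκ : 0 ≤ C * κ' := mul_nonneg hC0 hκ'0
    have hgm : Measurable fun x : ℝ≥0 =>
        ENNReal.ofReal (C * κ') * ENNReal.ofReal ((x : ℝ) ^ (-(1 / (Module.finrank ℚ E : ℝ)))) :=
      measurable_const.mul (measurable_coe_nnreal_real.pow_const _).ennreal_ofReal
    refine setLIntegral_lt_top_of_subset_thinSet hc hc1 μB μT
      (isClosed_mul_mul_setOf_adelicVal_mem hΩc hSTc).measurableSet hSTKc.measurableSet hΩCNc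
      (T₀ := 1) (fun b hb _ => hthin hb) hgm (fun b hb hHb => ?_) (fun T hT => ?_)
    · rw [← ENNReal.ofReal_mul hCκ, mul_assoc]
      exact ENNReal.ofReal_le_ofReal (mul_le_mul_of_nonneg_left (hglue b hb hHb.le) hC0)
    · rw [lintegral_const_mul' _ _ ENNReal.ofReal_ne_top]
      exact ENNReal.mul_lt_top ENNReal.ofReal_lt_top
        (setLIntegral_rpow_neg_borelHeight_lt_top_of_diagUnit hc μT hC₀c hC₁c hrayS (lt_trans one_pos hT) hn0)


/-- **THE ROW PACKAGE AT THE CM PAIR `(L⁺, L, complexConj)`** — `hBK` (★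
`exists_mem_borelAdelic_mul_mem_standardMaximalCompactGL_cm_three`) and `hdepth` (★
`exists_rational_borel_forall_valuation_conj_le`) discharged. [cite: Arthur1978TraceFormulaI, §8 (pp. 947–950)]
[cite: Rogawski1990, §2.2 (p. 13)] -/
theorem exists_rows_cm (L : Type) [Field L] [NumberField L] [IsCMField L] :
    ∃ S_dir : Set (Matrix (Fin 3) (Fin 3) (mixedSpace L)), IsCompact S_dir ∧
      ∀ [MeasurableSpace (adelicUnipotent (↥(maximalRealSubfield L)) L (IsCMField.complexConj L) 3)]
      [BorelSpace (adelicUnipotent (↥(maximalRealSubfield L)) L (IsCMField.complexConj L) 3)]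
      [MeasurableSpace (quasiSplit (↥(maximalRealSubfield L)) L (IsCMField.complexConj L) 3).Adelic]
      [BorelSpace (quasiSplit (↥(maximalRealSubfield L)) L (IsCMField.complexConj L) 3).Adelic]
      (ν : Measure (adelicUnipotent (↥(maximalRealSubfield L)) L (IsCMField.complexConj L) 3))
      [ν.IsHaarMeasure],
      ∃ (μB : Measure (borelAdelic (↥(maximalRealSubfield L)) L (IsCMField.complexConj L) 3))
        (_ : μB.IsHaarMeasure)
        (S : Set (borelAdelic (↥(maximalRealSubfield L)) L (IsCMField.complexConj L) 3))
        (Ω : Set (quasiSplit (↥(maximalRealSubfield L)) L (IsCMField.complexConj L) 3).Adelic)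
        (R₁ R₂ : Set (AdeleRing (𝓞 L) L)) (T₀ : ℝ≥0),
        IsClosed S ∧
        (∀ b ∈ S, ∀ k : borelAdelic (↥(maximalRealSubfield L)) L (IsCMField.complexConj L) 3,
          adelicVal (↥(maximalRealSubfield L)) L (IsCMField.complexConj L) 3 ((StdForm.antidiagonal 3).over L)
            (k : (quasiSplit (↥(maximalRealSubfield L)) L (IsCMField.complexConj L) 3).Adelic) ∈
            standardMaximalCompactGL 3 L → b * k ∈ S) ∧
        (∀ g : (quasiSplit (↥(maximalRealSubfield L)) L (IsCMField.complexConj L) 3).Adelic,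
          ∃ β : (quasiSplit (↥(maximalRealSubfield L)) L (IsCMField.complexConj L) 3).arithmeticSubgroup,
          β ∈ arithmeticBorel (↥(maximalRealSubfield L)) L (IsCMField.complexConj L) 3 ∧ ∃ b ∈ S,
          ∃ k : (quasiSplit (↥(maximalRealSubfield L)) L (IsCMField.complexConj L) 3).Adelic,
            adelicVal (↥(maximalRealSubfield L)) L (IsCMField.complexConj L) 3 ((StdForm.antidiagonal 3).over L) k ∈
              standardMaximalCompactGL 3 L ∧
            (β : (quasiSplit (↥(maximalRealSubfield L)) L (IsCMField.complexConj L) 3).Adelic) * g =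
              (b : (quasiSplit (↥(maximalRealSubfield L)) L (IsCMField.complexConj L) 3).Adelic) * k) ∧
        IsCompact Ω ∧ IsCompact R₁ ∧ IsCompact R₂ ∧
        (∀ b ∈ S, T₀ < borelHeight (b : (quasiSplit (↥(maximalRealSubfield L)) L (IsCMField.complexConj L) 3).Adelic) →
          (((torusPart b)⁻¹ * b : borelAdelic (↥(maximalRealSubfield L)) L (IsCMField.complexConj L) 3) :
              (quasiSplit (↥(maximalRealSubfield L)) L (IsCMField.complexConj L) 3).Adelic) ∈ Ω ∧
          (((diagUnit b.2 0)⁻¹ * diagUnit b.2 1 : (AdeleRing (𝓞 L) L)ˣ) : AdeleRing (𝓞 L) L) ∈ R₁ ∧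
          (((diagUnit b.2 0)⁻¹ * diagUnit b.2 2 : (AdeleRing (𝓞 L) L)ˣ) : AdeleRing (𝓞 L) L) ∈ R₂) ∧
        ∀ U ∈ finiteLevelsGL 3 L,
          ∃ (𝓕₀ W₀ : Set (adelicUnipotent (↥(maximalRealSubfield L)) L (IsCMField.complexConj L) 3))
            (ρ : borelAdelic (↥(maximalRealSubfield L)) L (IsCMField.complexConj L) 3 → ℝ),
          IsFundamentalDomain (rationalUnipotent (↥(maximalRealSubfield L)) L (IsCMField.complexConj L) 3) 𝓕₀ ν ∧
          IsCompact W₀ ∧ 𝓕₀ ⊆ W₀ ∧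
          (∀ b ∈ S, T₀ < borelHeight (b : (quasiSplit (↥(maximalRealSubfield L)) L (IsCMField.complexConj L) 3).Adelic) →
            ∀ k : (quasiSplit (↥(maximalRealSubfield L)) L (IsCMField.complexConj L) 3).Adelic,
            adelicVal (↥(maximalRealSubfield L)) L (IsCMField.complexConj L) 3 ((StdForm.antidiagonal 3).over L) k ∈
              standardMaximalCompactGL 3 L →
            ∀ u ∈ 𝓕₀, ∃ (t₁ t₂ t₃ : ℝ) (X₁ X₂ X₃ : Matrix (Fin 3) (Fin 3) (mixedSpace L))
              (w : GL (Fin 3) (AdeleRing (𝓞 L) L)),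
            X₁ ∈ S_dir ∧ X₂ ∈ S_dir ∧ X₃ ∈ S_dir ∧ w ∈ U ∧ |t₁| ≤ ρ b ∧ |t₂| ≤ ρ b ∧ |t₃| ≤ ρ b ∧
            adelicVal (↥(maximalRealSubfield L)) L (IsCMField.complexConj L) 3 _
                ((((b : (quasiSplit (↥(maximalRealSubfield L)) L (IsCMField.complexConj L) 3).Adelic) * k)⁻¹ *
                  (u : (quasiSplit (↥(maximalRealSubfield L)) L (IsCMField.complexConj L) 3).Adelic) *
                  ((b : (quasiSplit (↥(maximalRealSubfield L)) L (IsCMField.complexConj L) 3).Adelic) * k))) =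
              GLn.ofInfinite 3 L (expGL (t₁ • X₁) * expGL (t₂ • X₂) * expGL (t₃ • X₃)) * w) ∧
          (∀ T : ℝ≥0, T₀ < T →
            ∫⁻ b in S ∩ {b | T < borelHeight
                (b : (quasiSplit (↥(maximalRealSubfield L)) L (IsCMField.complexConj L) 3).Adelic)},
              ((torusRootModulus L 3 (diagUnit b.2) : ℝ≥0) : ℝ≥0∞) * ENNReal.ofReal (ρ b) ∂μB < ∞) := by
  exact exists_rows_of_levelDepth (complexConj_mul_complexConj L) (IsCMField.complexConj_ne_one L)
    (Algebra.IsQuadraticExtension.finrank_eq_two (↥(maximalRealSubfield L)) L)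
    (exists_mem_borelAdelic_mul_mem_standardMaximalCompactGL_cm_three L)
    (fun hΩ _ hW hSTt hexp _ h𝔫 =>
      exists_rational_borel_forall_valuation_conj_le (complexConj_mul_complexConj L) hΩ hW hSTt hexp h𝔫)

/-! ## §2 Every `k^T_𝔬` is integrable -/

/-- **EVERY `k^T_𝔬` IS INTEGRABLE for a quadratic `E/F`** (`c² = 1`, `c ≠ 1`, `[E:F] = 2`), given unimodularity
of `U(J₃)(𝔸_F)` and the adelic Iwasawa decomposition: ★ `truncatedKernelClassIntegrable_of_rows` fed with §1 and the
level depth ★ `exists_rational_borel_forall_valuation_conj_le`. [cite: Arthur1978TraceFormulaI, Thm. 7.1]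
[cite: Rogawski1990, §2.2 (p. 13)] -/
theorem truncatedKernelClassIntegrable_of_unimodular_iwasawa (hc : c * c = 1) (hc1 : c ≠ 1)
    (h2 : Module.finrank F E = 2)
    (hunimod : ∀ [MeasurableSpace (quasiSplit F E c 3).Adelic] [BorelSpace (quasiSplit F E c 3).Adelic]
      (νG : Measure (quasiSplit F E c 3).Adelic), νG.IsHaarMeasure → νG.IsMulRightInvariant)
    (hBK : ∀ g : (quasiSplit F E c 3).Adelic, ∃ b ∈ borelAdelic F E c 3, ∃ k : (quasiSplit F E c 3).Adelic,
      adelicVal F E c 3 ((StdForm.antidiagonal 3).over E) k ∈ standardMaximalCompactGL 3 E ∧ g = b * k)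
    {cl : (quasiSplit F E c 3).arithmeticSubgroup → ι} (hcl : IsConjInvariant cl)
    (hclN : IsUnipotentInvariantOnBorel F E c 3 cl) :
    ∀ [MeasurableSpace (adelicUnipotent F E c 3)] [BorelSpace (adelicUnipotent F E c 3)]
      (ν : Measure (adelicUnipotent F E c 3)) [ν.IsHaarMeasure]
      (𝓕 : Set (adelicUnipotent F E c 3)),
      IsFundamentalDomain (rationalUnipotent F E c 3) 𝓕 ν →
        ∀ (μ : Measure (quasiSplit F E c 3).automorphicQuotient)
          [(quasiSplit F E c 3).IsAutomorphicMeasure μ]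
          (f : (quasiSplit F E c 3).Adelic → ℂ), IsQuasiSplitTest F E c 3 f →
          ∀ i : ι, ∃ T₀ : ℝ≥0, ∀ T : ℝ≥0, T₀ < T →
            Integrable ((quasiSplit F E c 3).quotFun (truncatedKernelClass ν 𝓕 T cl i f)) μ := by
  obtain ⟨S_dir, hSdir, hrows⟩ := exists_rows_of_levelDepth hc hc1 h2 hBK
    (fun hΩ _ hW hSTt hexp _ h𝔫 => exists_rational_borel_forall_valuation_conj_le hc hΩ hW hSTt hexp h𝔫)
  exact truncatedKernelClassIntegrable_of_rows hc hc1 hunimod hBK hcl hclN hSdir hrows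

/-- **EVERY `k^T_𝔬` IS INTEGRABLE, at the CM pair `(L⁺, L, complexConj)`** — Arthur's Theorem 7.1 ∕ Rogawski's
«`k^T_𝔬` is integrable over `G(F)\G(𝔸_F)`» for the quasi-split `U(J₃)` attached to a CM field `L`, for EVERY
conjugation-invariant `N(F)`-saturated class map `cl : G(F) → ι` (e.g. the characteristic-polynomial classes of ★
`UnitaryGroupCharpolyClassMap`): for every Haar measure `ν` of `N(𝔸)`, fundamental domain `𝓕` of `N(F)`, automorphic
measure `μ`, test function `f` and class `𝔬` there is `T₀` with `[g] ↦ k^T_𝔬(g⁻¹)` `μ`-integrable for all `T > T₀`.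
NO HYPOTHESIS beyond the class-map axioms. [cite: Arthur1978TraceFormulaI, Thm. 7.1] [cite: Rogawski1990, §2.2 (p. 13)] -/
theorem truncatedKernelClassIntegrable_cm (L : Type) [Field L] [NumberField L] [IsCMField L]
    {cl : (quasiSplit (↥(maximalRealSubfield L)) L (IsCMField.complexConj L) 3).arithmeticSubgroup → ι}
    (hcl : IsConjInvariant cl)
    (hclN : IsUnipotentInvariantOnBorel (↥(maximalRealSubfield L)) L (IsCMField.complexConj L) 3 cl) :
    ∀ [MeasurableSpace (adelicUnipotent (↥(maximalRealSubfield L)) L (IsCMField.complexConj L) 3)]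
      [BorelSpace (adelicUnipotent (↥(maximalRealSubfield L)) L (IsCMField.complexConj L) 3)]
      (ν : Measure (adelicUnipotent (↥(maximalRealSubfield L)) L (IsCMField.complexConj L) 3)) [ν.IsHaarMeasure]
      (𝓕 : Set (adelicUnipotent (↥(maximalRealSubfield L)) L (IsCMField.complexConj L) 3)),
      IsFundamentalDomain (rationalUnipotent (↥(maximalRealSubfield L)) L (IsCMField.complexConj L) 3) 𝓕 ν →
        ∀ (μ : Measure (quasiSplit (↥(maximalRealSubfield L)) L (IsCMField.complexConj L) 3).automorphicQuotient)
          [(quasiSplit (↥(maximalRealSubfield L)) L (IsCMField.complexConj L) 3).IsAutomorphicMeasure μ]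
          (f : (quasiSplit (↥(maximalRealSubfield L)) L (IsCMField.complexConj L) 3).Adelic → ℂ),
          IsQuasiSplitTest (↥(maximalRealSubfield L)) L (IsCMField.complexConj L) 3 f →
          ∀ i : ι, ∃ T₀ : ℝ≥0, ∀ T : ℝ≥0, T₀ < T →
            Integrable ((quasiSplit (↥(maximalRealSubfield L)) L (IsCMField.complexConj L) 3).quotFun
              (truncatedKernelClass ν 𝓕 T cl i f)) μ := by
  obtain ⟨S_dir, hSdir, hrows⟩ := exists_rows_cm L
  exact truncatedKernelClassIntegrable_cm_of_rows L hcl hclN hSdir hrows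

end UnitaryGroup

end Literature.NumberTheory.Automorphic
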